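import Literature.MathematicalPhysics.QuantumFieldTheory.Balaban1983to89.B14Ineq319Proof
import Literature.MathematicalPhysics.QuantumFieldTheory.Balaban1983to89.B15Ineq142Proof

/-!
# `Balaban1983to89.B15Ineq142From190` — [Balaban1989LargeFieldI] (1.42) p. 185, the MIDDLE MEMBER and «≦ ½δ_j»
# ON THE LATTICE MODEL END-TO-END FROM [15] (190): r12's `B15Ineq142Proof.boundH141_of_ineq190` (the bound on
# `ℍ_{j+1,□′}` from (190), one localised piece) composed with p29's `B14Ineq319Proof.ineq142_middle_local` (the
# (1.40)–(1.41)/(1.37) mechanism *"without the factor L"* in the commutative lattice model), the «≦ ½δ_j» clause from γ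

statement-level skeleton of published theorems with citation tags; proofs where landed; nothing here is a claim about
the Yang–Mills mass gap.

CITATION HEADER (lean-in-tree rule 2026-08-18).  T. Bałaban, *Large field renormalization. I. The basic step of the 𝐑
operation*, Commun. Math. Phys. **122**, 175–202 (1989), doi:10.1007/BF01257412, bib `Balaban1989LargeFieldI` (cell paper
B15; PDF held `paper:balaban1989-cmp122-large-field-i`; p. 185 = PDF 11, OCR `p0011.txt` + x2 render).  "[15]" =
[Balaban1985Variational] (190) p. 308 (`B11SectG.Ineq190`); "[3]" = [Balaban1984PropagatorsII] (2.61) (`B11SectG.RowSum`);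
"[12]" = [Balaban1985Averaging] (106)–(108)/(159)–(166) (`B7Eq162General`, `B7Eq84Concrete.glev`); "[III]" =
[Balaban1988Convergent] (2.5) (`B14.IsRj`).  WHAT IS REPRODUCED: SKELETON row `B15.Eq1.42` (middle member, «≦ ½δ_j»),
unit `lit-balaban-r12` gen 8, HOME `run/shared/lean/pub/lit-balaban/` (`lit-balaban-r12/ROWS-B15.md`).  KNITTING — used BY
NAME, nothing restated: `B15Ineq142Proof.boundH141_of_ineq190` (r12 g8), `B14Ineq319Proof.ineq142_middle_local` (p29 g6 v1.1),
`B15GammaSmallness.exp_neg_mul_R_le_gamma_sq` (r12 g8).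

THE PRINTED TEXT (p. 185 [PDF 11], verbatim, re-read on the page image): *"For the configuration (1.41) we have again the bound
(1.37), with ℍ replaced by ℍ_{j+1,□′} on the right-hand side, and without the factor L. The function ℍ_{j+1,□′} is bounded on □′^{∼2}
by B₃exp(−δLM₂R_{j+1})22d²ε_{j+1}, hence |V^{(j)}_{□′}(b) − V^{(j)}_Z(b)| = |exp iℍ^{(j)}_{□′}(b) − 1| <
O(1)B₃exp(−δLM₂R_{j+1})22d²(1 + β₀)(A₀/A₁)δ_j ≦ ½δ_j (1.42) on □′^{∼2}."*  (v1.2, r12 gen 19, `lit-balaban-r12/QUOTE-AUDIT-B15.md`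
finding A1: DOCSTRING ONLY — v1/v1.1 carried inside the quotation marks the unprinted paraphrase «hence using (1.40) and the bound (1.37)
(more exactly a corresponding bound without the factor L), we obtain»; restored verbatim; no declaration, statement or proof changed.)

WHAT THIS FILE PROVES (kernel-checked, zero `sorry`; no `def`, no new `Prop`, no new named fact; axioms standard).
* `ineq142_middle_lattice_of_ineq190` — the middle member of (1.42) for p29's lattice expression
  `|M^j((e^{iL^{−(j+1)}ℍ}U₀)^{u⁻¹})(b)·M^j(U₀)(b)⁻¹ − 1| ≤ (68(d+1)+160d)·B₃e^{−δLM₂R}22d²(1+β₀)(A₀/A₁)δ_j` with the bound on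
  `ℍ = ℍ_{j+1,□′}` on `B^j(b₋) ∪ B^j(b₊)` NOT assumed but DERIVED from [15] (190): (190) for the block size `bout` at the base
  point `y` and every `t`, (2.61) at rate `σ`, `σ + τ ≤ ⅛δ₀`, the argument field of B-size `≤ 22d²ε_{j+1}` vanishing on the
  blocks closer than `D` to `y`, `δLM₂R ≤ τD`, `Cκ_Bc ≤ B₃`, mean-value domination, and ONE dictionary hypothesis `hdom`: the
  block size `bout.loc y ℍ` dominates `‖ℍ(y′, μ)‖` at the sites `y′` of `B^j(b₋) ∪ B^j(b₊)`; p29's lattice side conditions verbatim.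
* `ineq142_le_half_lattice_of_ineq190_gamma` — «≦ ½δ_j» for the same expression, the last step from γ: `R = R_{j+1}` as in
  (2.5) (`r ≥ 1`), `0 < g_{j+1} ≤ γ`, `log γ⁻² ≥ 1`, `δLM₂ ≥ 1`, signs, and the explicit clause
  `(68(d+1)+160d)·B₃22d²(1+β₀)(A₀/A₁)γ² ≤ ½` (one of the clauses of `B15GammaClauses.gamma_clauses_eventually`).
* §2 (v1.1) `located142_of_gamma`, `ineq142_le_half_lattice_of_ineq190_gamma'` — p29's five located `s`-conditions derived from
  `ε_j ≤ 1`, `d ≥ 1` and three explicit clauses in γ and the (52)-parameter `α₀` (X ≤ B₃22d²(1+β₀)γ²).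
HONEST SCOPE.  (190) and the dictionary `hdom` are hypotheses; the lattice model is p29's (commutative-`𝔸` carriers of [12]/[14],
gauge fixing `glev`, (52)-type input `pdev U₀ < α₀L^{−2j}`); located side conditions as in `B14Ineq319Proof`.  NOT summit progress.
-/

open NormedSpace Finset

namespace Literature.MathematicalPhysics.QuantumFieldTheory.Balaban1983to89.B15Ineq142From190

open Literature.MathematicalPhysics.QuantumFieldTheory.Balaban1983to89
open B7Prop1Explicit B7Prop2Explicit B7Prop3Flat B7Eq92Concrete B7Eq162General
open B11SectG B15Ineq142Proof B15GammaSmallness B14Ineq319Proof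

variable {d : ℕ}
-- `𝔸` in `Type` (not `Type*`): `B11SectG.BlockNorm` takes its field space in `Type`.
variable {𝔸 : Type} [NormedRing 𝔸] [NormedAlgebra ℂ 𝔸] [CompleteSpace 𝔸] [NormOneClass 𝔸]
variable {g : B6.Geometry} {FB : Type} [AddCommGroup FB] [Module ℝ FB]

/-- **(1.42), MIDDLE MEMBER, ON THE LATTICE MODEL, FROM [15] (190)**: `boundH141_of_ineq190` (the bound on `ℍ_{j+1,□′}` for
the block size `bout` at the base point `y`) ∘ the dictionary `hdom` (that size dominates `‖ℍ(y′,μ)‖` on `B^j(b₋) ∪ B^j(b₊)`)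
∘ p29's `ineq142_middle_local`. [cite: Balaban1989LargeFieldI, (1.42) p.185; Balaban1985Variational, (190) p.308] -/
theorem ineq142_middle_lattice_of_ineq190
    -- [15]'s block-majorant data
    {T : Type*} {bB : BlockNorm g FB} {bout : BlockNorm g (B7Prop1Explicit.Site d → Fin d → 𝔸)}
    {dH : T → FB →ₗ[ℝ] (B7Prop1Explicit.Site d → Fin d → 𝔸)} {C δ₀ σ τ c D : ℝ}
    (h190 : ∀ t, Ineq190 bB bout (dH t) C δ₀) (hC : 0 ≤ C) (hd : ∀ a b : g.Site, 0 ≤ g.dist a b)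
    (hrow : RowSum g σ c) (hτ : 0 ≤ τ) (hστ : σ + τ ≤ δ₀ / 8) (B : FB) (y : g.Site)
    {B₃ δ M₂ R β₀ A₀ A₁ εj εj1 δj : ℝ}
    (hm : ∀ y', bB.loc y' B ≤ 22 * (d : ℝ) ^ 2 * εj1) (hD : ∀ y', bB.loc y' B ≠ 0 → D ≤ g.dist y y')
    {Hf : B7Prop1Explicit.Site d → Fin d → 𝔸}
    (hmv : ∀ s : ℝ, (∀ t, bout.loc y (dH t B) ≤ s) → bout.loc y Hf ≤ s)
    -- the lattice data (p29)
    {L : ℕ} (hL : 2 ≤ L) {G : Subgroup 𝔸ˣ} (hG : AvgClosed d L G) {j : ℕ}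
    {U₀ : B7Prop1Explicit.Site d → Fin d → 𝔸ˣ} (hU₀ : ∀ x κ, U₀ x κ ∈ G) {α₀ : ℝ} (hα : 0 < α₀)
    (hα3 : C0 d * α₀ ≤ 1 / 3) (hα4 : 4 * α₀ ≤ c2' d L) (h52 : pdev U₀ < α₀ * (((L : ℝ) ^ j)⁻¹) ^ 2)
    (q : B7Prop1Explicit.Site d) (κ : Fin d)
    (hgeom : δ * L * M₂ * R ≤ τ * D) (hCB : C * bB.κ * c ≤ B₃) (hB₃ : 0 ≤ B₃) (hε : 0 ≤ εj1)
    -- the dictionary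
    (hdom : ∀ y' μ, B7Prop1Local.InBox (B7Prop1Local.loK L j q) (B7Prop1Local.bondHiK L j q κ) y' → ‖Hf y' μ‖ ≤ bout.loc y Hf)
    (hflow : εj1 ≤ (1 + β₀) * εj) (hεδ : εj = A₀ / A₁ * δj)
    (hS0 : 0 ≤ B₃ * Real.exp (-(δ * L * M₂ * R)) * (22 * d ^ 2) * (1 + β₀) * (A₀ / A₁) * δj)
    (hsmall : Real.exp (4 * (800 * ((d : ℝ) + 1) ^ 2 * ((d : ℝ) + 4)) * α₀)
      * (1 + 8 * (131072 * ((d : ℝ) + 1) ^ 2)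
        * (B₃ * Real.exp (-(δ * L * M₂ * R)) * (22 * d ^ 2) * (1 + β₀) * (A₀ / A₁) * δj)) ≤ 2)
    (hc₃ : 2 * (B₃ * Real.exp (-(δ * L * M₂ * R)) * (22 * d ^ 2) * (1 + β₀) * (A₀ / A₁) * δj) ≤ c3 d L)
    (hsm : 2048 * (d : ℝ) * (B₃ * Real.exp (-(δ * L * M₂ * R)) * (22 * d ^ 2) * (1 + β₀) * (A₀ / A₁) * δj) ≤ 1)
    (h1 : 128 * (B₃ * Real.exp (-(δ * L * M₂ * R)) * (22 * d ^ 2) * (1 + β₀) * (A₀ / A₁) * δj) ≤ 1) (hL1 : 1 ≤ L) :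
    ‖((avgIter L
          (gaugeAct (B7Eq84Concrete.glev L hL1 U₀
              (expCfg (fun y μ => ((Complex.I : ℂ) * ((((L : ℝ) ^ (j + 1))⁻¹ : ℝ) : ℂ)) • Hf y μ)) j 0)⁻¹
            (expCfg (fun y μ => ((Complex.I : ℂ) * ((((L : ℝ) ^ (j + 1))⁻¹ : ℝ) : ℂ)) • Hf y μ) * U₀)) j q κ : 𝔸ˣ) : 𝔸)
        * (((avgIter L U₀ j q κ)⁻¹ : 𝔸ˣ) : 𝔸) - 1‖
      ≤ (68 * ((d : ℝ) + 1) + 160 * d) * B₃ * Real.exp (-(δ * L * M₂ * R)) * (22 * d ^ 2) * (1 + β₀) * (A₀ / A₁) * δj := by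
  have hloc := boundH141_of_ineq190 h190 hC hd hrow hτ hστ B y hm hD hmv hgeom hCB hB₃ hε
  have hH : ∀ y' μ, B7Prop1Local.InBox (B7Prop1Local.loK L j q) (B7Prop1Local.bondHiK L j q κ) y' →
      ‖Hf y' μ‖ ≤ B₃ * Real.exp (-(δ * L * M₂ * R)) * (22 * d ^ 2) * εj1 :=
    fun y' μ hy => (hdom y' μ hy).trans hloc
  exact ineq142_middle_local hL hG hU₀ hα hα3 hα4 h52 Hf q κ hB₃ hH hflow hεδ hS0 hsmall hc₃ hsm h1 hL1

/-- **(1.42), «≦ ½δ_j», ON THE LATTICE MODEL, FROM [15] (190) AND γ**: as `ineq142_middle_lattice_of_ineq190`, the last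
step from `R = R_{j+1}` as in (2.5) [III] (`r ≥ 1`), `0 < g_{j+1} ≤ γ`, `log γ⁻² ≥ 1`, `δLM₂ ≥ 1`, the signs `1 + β₀ ≥ 0`,
`A₀/A₁ ≥ 0`, `δ_j ≥ 0`, and the explicit γ-clause `(68(d+1)+160d)·B₃22d²(1+β₀)(A₀/A₁)γ² ≤ ½`.
[cite: Balaban1989LargeFieldI, (1.42) p.185; Balaban1988Convergent, (2.5) p.255] -/
theorem ineq142_le_half_lattice_of_ineq190_gamma
    {T : Type*} {bB : BlockNorm g FB} {bout : BlockNorm g (B7Prop1Explicit.Site d → Fin d → 𝔸)}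
    {dH : T → FB →ₗ[ℝ] (B7Prop1Explicit.Site d → Fin d → 𝔸)} {C δ₀ σ τ c D : ℝ}
    (h190 : ∀ t, Ineq190 bB bout (dH t) C δ₀) (hC : 0 ≤ C) (hd : ∀ a b : g.Site, 0 ≤ g.dist a b)
    (hrow : RowSum g σ c) (hτ : 0 ≤ τ) (hστ : σ + τ ≤ δ₀ / 8) (B : FB) (y : g.Site)
    {B₃ δ M₂ β₀ A₀ A₁ εj εj1 δj γ gj1 : ℝ} {R r : ℕ}
    (hm : ∀ y', bB.loc y' B ≤ 22 * (d : ℝ) ^ 2 * εj1) (hD : ∀ y', bB.loc y' B ≠ 0 → D ≤ g.dist y y')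
    {Hf : B7Prop1Explicit.Site d → Fin d → 𝔸}
    (hmv : ∀ s : ℝ, (∀ t, bout.loc y (dH t B) ≤ s) → bout.loc y Hf ≤ s)
    {L : ℕ} (hL : 2 ≤ L) {G : Subgroup 𝔸ˣ} (hG : AvgClosed d L G) {j : ℕ}
    {U₀ : B7Prop1Explicit.Site d → Fin d → 𝔸ˣ} (hU₀ : ∀ x κ, U₀ x κ ∈ G) {α₀ : ℝ} (hα : 0 < α₀)
    (hα3 : C0 d * α₀ ≤ 1 / 3) (hα4 : 4 * α₀ ≤ c2' d L) (h52 : pdev U₀ < α₀ * (((L : ℝ) ^ j)⁻¹) ^ 2)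
    (q : B7Prop1Explicit.Site d) (κ : Fin d)
    (hgeom : δ * L * M₂ * R ≤ τ * D) (hCB : C * bB.κ * c ≤ B₃) (hB₃ : 0 ≤ B₃) (hε : 0 ≤ εj1)
    (hdom : ∀ y' μ, B7Prop1Local.InBox (B7Prop1Local.loK L j q) (B7Prop1Local.bondHiK L j q κ) y' → ‖Hf y' μ‖ ≤ bout.loc y Hf)
    (hflow : εj1 ≤ (1 + β₀) * εj) (hεδ : εj = A₀ / A₁ * δj)
    (hS0 : 0 ≤ B₃ * Real.exp (-(δ * L * M₂ * R)) * (22 * d ^ 2) * (1 + β₀) * (A₀ / A₁) * δj)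
    (hsmall : Real.exp (4 * (800 * ((d : ℝ) + 1) ^ 2 * ((d : ℝ) + 4)) * α₀)
      * (1 + 8 * (131072 * ((d : ℝ) + 1) ^ 2)
        * (B₃ * Real.exp (-(δ * L * M₂ * R)) * (22 * d ^ 2) * (1 + β₀) * (A₀ / A₁) * δj)) ≤ 2)
    (hc₃ : 2 * (B₃ * Real.exp (-(δ * L * M₂ * R)) * (22 * d ^ 2) * (1 + β₀) * (A₀ / A₁) * δj) ≤ c3 d L)
    (hsm : 2048 * (d : ℝ) * (B₃ * Real.exp (-(δ * L * M₂ * R)) * (22 * d ^ 2) * (1 + β₀) * (A₀ / A₁) * δj) ≤ 1)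
    (h1 : 128 * (B₃ * Real.exp (-(δ * L * M₂ * R)) * (22 * d ^ 2) * (1 + β₀) * (A₀ / A₁) * δj) ≤ 1) (hL1 : 1 ≤ L)
    -- the γ data for «≦ ½δ_j»
    (hr : 1 ≤ r) (hR : B14.IsRj L r gj1 R) (hg : 0 < gj1) (hgγ : gj1 ≤ γ) (hγe : 1 ≤ Real.log (γ ^ 2)⁻¹)
    (hc1 : 1 ≤ δ * L * M₂) (hβ₀ : 0 ≤ 1 + β₀) (hA : 0 ≤ A₀ / A₁) (hδj : 0 ≤ δj)
    (hγ : (68 * ((d : ℝ) + 1) + 160 * d) * B₃ * (22 * d ^ 2) * (1 + β₀) * (A₀ / A₁) * γ ^ 2 ≤ 1 / 2) :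
    ‖((avgIter L
          (gaugeAct (B7Eq84Concrete.glev L hL1 U₀
              (expCfg (fun y μ => ((Complex.I : ℂ) * ((((L : ℝ) ^ (j + 1))⁻¹ : ℝ) : ℂ)) • Hf y μ)) j 0)⁻¹
            (expCfg (fun y μ => ((Complex.I : ℂ) * ((((L : ℝ) ^ (j + 1))⁻¹ : ℝ) : ℂ)) • Hf y μ) * U₀)) j q κ : 𝔸ˣ) : 𝔸)
        * (((avgIter L U₀ j q κ)⁻¹ : 𝔸ˣ) : 𝔸) - 1‖ ≤ δj / 2 := by
  have hmid := ineq142_middle_lattice_of_ineq190 h190 hC hd hrow hτ hστ B y hm hD hmv hL hG hU₀ hα hα3 hα4 h52 q κ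
    hgeom hCB hB₃ hε hdom hflow hεδ hS0 hsmall hc₃ hsm h1 hL1
  have h2 : Real.exp (-(δ * L * M₂ * R)) ≤ γ ^ 2 := by
    have h := exp_neg_mul_R_le_gamma_sq (c := δ * L * M₂) hr hR hg hgγ hγe hc1
    simpa [mul_assoc] using h
  have hK : 0 ≤ (68 * ((d : ℝ) + 1) + 160 * d) * B₃ * (22 * d ^ 2) * (1 + β₀) * (A₀ / A₁) := by positivity
  have hγ' : (68 * ((d : ℝ) + 1) + 160 * d) * B₃ * Real.exp (-(δ * L * M₂ * R)) * (22 * d ^ 2) * (1 + β₀) * (A₀ / A₁)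
      ≤ 1 / 2 :=
    calc (68 * ((d : ℝ) + 1) + 160 * d) * B₃ * Real.exp (-(δ * L * M₂ * R)) * (22 * d ^ 2) * (1 + β₀) * (A₀ / A₁)
        = (68 * ((d : ℝ) + 1) + 160 * d) * B₃ * (22 * d ^ 2) * (1 + β₀) * (A₀ / A₁) * Real.exp (-(δ * L * M₂ * R)) := by
          ring
      _ ≤ (68 * ((d : ℝ) + 1) + 160 * d) * B₃ * (22 * d ^ 2) * (1 + β₀) * (A₀ / A₁) * γ ^ 2 :=
          mul_le_mul_of_nonneg_left h2 hK
      _ ≤ 1 / 2 := hγ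
  refine hmid.trans ?_
  have := mul_le_mul_of_nonneg_right hγ' hδj
  linarith

/-! ## §2 (v1.1). The located `s`-conditions from γ -/

/-- The located side conditions of p29's `ineq142_middle_local` (`hS0`, `hsmall`, `hc₃`, `hsm`, `h1`, all on the quantity
`X = B₃e^{−δLM₂R}22d²(1+β₀)(A₀/A₁)δ_j`) FROM γ: with `e^{−δLM₂R} ≤ γ²` ((2.5), `δLM₂ ≥ 1`), `ε_j = (A₀/A₁)δ_j ≤ 1` and signs,
`X ≤ X_γ := B₃22d²(1+β₀)γ²`, so the three explicit clauses `2048d·X_γ ≤ 1`, `2X_γ ≤ c₃(d,L)`,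
`exp(4·800(d+1)²(d+4)α₀)(1 + 8·131072(d+1)²X_γ) ≤ 2` (`d ≥ 1`) imply them. [cite: Balaban1989LargeFieldI, (1.42) p.185] -/
theorem located142_of_gamma {d L r R : ℕ} {B₃ δ M₂ β₀ A₀ A₁ εj δj γ gj1 α₀ : ℝ} (hd1 : 1 ≤ d)
    (hr : 1 ≤ r) (hR : B14.IsRj L r gj1 R) (hg : 0 < gj1) (hgγ : gj1 ≤ γ) (hγe : 1 ≤ Real.log (γ ^ 2)⁻¹)
    (hc1 : 1 ≤ δ * L * M₂) (hB₃ : 0 ≤ B₃) (hβ₀ : 0 ≤ 1 + β₀) (hδj : 0 ≤ δj) (hA : 0 ≤ A₀ / A₁)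
    (hεδ : εj = A₀ / A₁ * δj) (hεj1 : εj ≤ 1)
    (hsmγ : 2048 * (d : ℝ) * (B₃ * (22 * (d : ℝ) ^ 2) * (1 + β₀) * γ ^ 2) ≤ 1)
    (hc₃γ : 2 * (B₃ * (22 * (d : ℝ) ^ 2) * (1 + β₀) * γ ^ 2) ≤ c3 d L)
    (hsmallγ : Real.exp (4 * (800 * ((d : ℝ) + 1) ^ 2 * ((d : ℝ) + 4)) * α₀)
      * (1 + 8 * (131072 * ((d : ℝ) + 1) ^ 2) * (B₃ * (22 * (d : ℝ) ^ 2) * (1 + β₀) * γ ^ 2)) ≤ 2) :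
    0 ≤ B₃ * Real.exp (-(δ * L * M₂ * R)) * (22 * d ^ 2) * (1 + β₀) * (A₀ / A₁) * δj ∧
    Real.exp (4 * (800 * ((d : ℝ) + 1) ^ 2 * ((d : ℝ) + 4)) * α₀)
      * (1 + 8 * (131072 * ((d : ℝ) + 1) ^ 2)
        * (B₃ * Real.exp (-(δ * L * M₂ * R)) * (22 * d ^ 2) * (1 + β₀) * (A₀ / A₁) * δj)) ≤ 2 ∧
    2 * (B₃ * Real.exp (-(δ * L * M₂ * R)) * (22 * d ^ 2) * (1 + β₀) * (A₀ / A₁) * δj) ≤ c3 d L ∧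
    2048 * (d : ℝ) * (B₃ * Real.exp (-(δ * L * M₂ * R)) * (22 * d ^ 2) * (1 + β₀) * (A₀ / A₁) * δj) ≤ 1 ∧
    128 * (B₃ * Real.exp (-(δ * L * M₂ * R)) * (22 * d ^ 2) * (1 + β₀) * (A₀ / A₁) * δj) ≤ 1 := by
  set X := B₃ * Real.exp (-(δ * L * M₂ * R)) * (22 * d ^ 2) * (1 + β₀) * (A₀ / A₁) * δj with hX
  set Xγ := B₃ * (22 * (d : ℝ) ^ 2) * (1 + β₀) * γ ^ 2 with hXγ
  have hX0 : 0 ≤ X := by positivity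
  have he : Real.exp (-(δ * L * M₂ * R)) ≤ γ ^ 2 := by
    have h := exp_neg_mul_R_le_gamma_sq (c := δ * L * M₂) hr hR hg hgγ hγe hc1
    simpa [mul_assoc] using h
  have hεj0 : 0 ≤ εj := by rw [hεδ]; positivity
  -- X = B₃22d²(1+β₀)·e^{…}·ε_j ≤ Xγ
  have hXle : X ≤ Xγ := by
    have e1 : X = B₃ * (22 * (d : ℝ) ^ 2) * (1 + β₀) * (Real.exp (-(δ * L * M₂ * R)) * εj) := by
      rw [hX, hεδ]; ring
    have h2 : Real.exp (-(δ * L * M₂ * R)) * εj ≤ γ ^ 2 * 1 :=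
      mul_le_mul he hεj1 hεj0 (by positivity)
    have hK : 0 ≤ B₃ * (22 * (d : ℝ) ^ 2) * (1 + β₀) := by positivity
    calc X = B₃ * (22 * (d : ℝ) ^ 2) * (1 + β₀) * (Real.exp (-(δ * L * M₂ * R)) * εj) := e1
      _ ≤ B₃ * (22 * (d : ℝ) ^ 2) * (1 + β₀) * (γ ^ 2 * 1) := mul_le_mul_of_nonneg_left h2 hK
      _ = Xγ := by rw [hXγ]; ring
  have hd' : (1 : ℝ) ≤ d := by exact_mod_cast hd1
  refine ⟨hX0, ?_, ?_, ?_, ?_⟩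
  · have hexp : 0 ≤ Real.exp (4 * (800 * ((d : ℝ) + 1) ^ 2 * ((d : ℝ) + 4)) * α₀) := (Real.exp_pos _).le
    have hin : 1 + 8 * (131072 * ((d : ℝ) + 1) ^ 2) * X ≤ 1 + 8 * (131072 * ((d : ℝ) + 1) ^ 2) * Xγ := by
      have := mul_le_mul_of_nonneg_left hXle (by positivity : (0 : ℝ) ≤ 8 * (131072 * ((d : ℝ) + 1) ^ 2))
      linarith
    exact (mul_le_mul_of_nonneg_left hin hexp).trans hsmallγ
  · linarith
  · have := mul_le_mul_of_nonneg_left hXle (by positivity : (0 : ℝ) ≤ 2048 * (d : ℝ))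
    linarith
  · have h2048 : 128 * X ≤ 2048 * (d : ℝ) * X := by nlinarith
    have := mul_le_mul_of_nonneg_left hXle (by positivity : (0 : ℝ) ≤ 2048 * (d : ℝ))
    linarith

/-- **(1.42), «≦ ½δ_j», ON THE LATTICE, FROM [15] (190) AND γ — located side conditions from γ too**: as
`ineq142_le_half_lattice_of_ineq190_gamma` with p29's five located `s`-conditions replaced by `ε_j ≤ 1`, `d ≥ 1` and the three
explicit clauses of `located142_of_gamma` (in γ and the (52)-parameter `α₀`). [cite: Balaban1989LargeFieldI, (1.42) p.185; Balaban1988Convergent, (2.5) p.255] -/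
theorem ineq142_le_half_lattice_of_ineq190_gamma'
    {T : Type*} {bB : BlockNorm g FB} {bout : BlockNorm g (B7Prop1Explicit.Site d → Fin d → 𝔸)}
    {dH : T → FB →ₗ[ℝ] (B7Prop1Explicit.Site d → Fin d → 𝔸)} {C δ₀ σ τ c D : ℝ}
    (h190 : ∀ t, Ineq190 bB bout (dH t) C δ₀) (hC : 0 ≤ C) (hd : ∀ a b : g.Site, 0 ≤ g.dist a b)
    (hrow : RowSum g σ c) (hτ : 0 ≤ τ) (hστ : σ + τ ≤ δ₀ / 8) (B : FB) (y : g.Site)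
    {B₃ δ M₂ β₀ A₀ A₁ εj εj1 δj γ gj1 : ℝ} {R r : ℕ}
    (hm : ∀ y', bB.loc y' B ≤ 22 * (d : ℝ) ^ 2 * εj1) (hD : ∀ y', bB.loc y' B ≠ 0 → D ≤ g.dist y y')
    {Hf : B7Prop1Explicit.Site d → Fin d → 𝔸}
    (hmv : ∀ s : ℝ, (∀ t, bout.loc y (dH t B) ≤ s) → bout.loc y Hf ≤ s)
    {L : ℕ} (hL : 2 ≤ L) {G : Subgroup 𝔸ˣ} (hG : AvgClosed d L G) {j : ℕ}
    {U₀ : B7Prop1Explicit.Site d → Fin d → 𝔸ˣ} (hU₀ : ∀ x κ, U₀ x κ ∈ G) {α₀ : ℝ} (hα : 0 < α₀)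
    (hα3 : C0 d * α₀ ≤ 1 / 3) (hα4 : 4 * α₀ ≤ c2' d L) (h52 : pdev U₀ < α₀ * (((L : ℝ) ^ j)⁻¹) ^ 2)
    (q : B7Prop1Explicit.Site d) (κ : Fin d)
    (hgeom : δ * L * M₂ * R ≤ τ * D) (hCB : C * bB.κ * c ≤ B₃) (hB₃ : 0 ≤ B₃) (hε : 0 ≤ εj1)
    (hdom : ∀ y' μ, B7Prop1Local.InBox (B7Prop1Local.loK L j q) (B7Prop1Local.bondHiK L j q κ) y' → ‖Hf y' μ‖ ≤ bout.loc y Hf)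
    (hflow : εj1 ≤ (1 + β₀) * εj) (hεδ : εj = A₀ / A₁ * δj) (hL1 : 1 ≤ L)
    -- γ data
    (hr : 1 ≤ r) (hR : B14.IsRj L r gj1 R) (hg : 0 < gj1) (hgγ : gj1 ≤ γ) (hγe : 1 ≤ Real.log (γ ^ 2)⁻¹)
    (hc1 : 1 ≤ δ * L * M₂) (hβ₀ : 0 ≤ 1 + β₀) (hA : 0 ≤ A₀ / A₁) (hδj : 0 ≤ δj)
    (hγ : (68 * ((d : ℝ) + 1) + 160 * d) * B₃ * (22 * d ^ 2) * (1 + β₀) * (A₀ / A₁) * γ ^ 2 ≤ 1 / 2)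
    -- the located conditions in γ/α₀ form
    (hd1 : 1 ≤ d) (hεj1 : εj ≤ 1)
    (hsmγ : 2048 * (d : ℝ) * (B₃ * (22 * (d : ℝ) ^ 2) * (1 + β₀) * γ ^ 2) ≤ 1)
    (hc₃γ : 2 * (B₃ * (22 * (d : ℝ) ^ 2) * (1 + β₀) * γ ^ 2) ≤ c3 d L)
    (hsmallγ : Real.exp (4 * (800 * ((d : ℝ) + 1) ^ 2 * ((d : ℝ) + 4)) * α₀)
      * (1 + 8 * (131072 * ((d : ℝ) + 1) ^ 2) * (B₃ * (22 * (d : ℝ) ^ 2) * (1 + β₀) * γ ^ 2)) ≤ 2) :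
    ‖((avgIter L
          (gaugeAct (B7Eq84Concrete.glev L hL1 U₀
              (expCfg (fun y μ => ((Complex.I : ℂ) * ((((L : ℝ) ^ (j + 1))⁻¹ : ℝ) : ℂ)) • Hf y μ)) j 0)⁻¹
            (expCfg (fun y μ => ((Complex.I : ℂ) * ((((L : ℝ) ^ (j + 1))⁻¹ : ℝ) : ℂ)) • Hf y μ) * U₀)) j q κ : 𝔸ˣ) : 𝔸)
        * (((avgIter L U₀ j q κ)⁻¹ : 𝔸ˣ) : 𝔸) - 1‖ ≤ δj / 2 := by
  obtain ⟨hS0, hsmall, hc₃, hsm, h1⟩ := located142_of_gamma (R := R) hd1 hr hR hg hgγ hγe hc1 hB₃ hβ₀ hδj hA hεδ hεj1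
    hsmγ hc₃γ hsmallγ
  exact ineq142_le_half_lattice_of_ineq190_gamma h190 hC hd hrow hτ hστ B y hm hD hmv hL hG hU₀ hα hα3 hα4 h52 q κ hgeom
    hCB hB₃ hε hdom hflow hεδ hS0 hsmall hc₃ hsm h1 hL1 hr hR hg hgγ hγe hc1 hβ₀ hA hδj hγ

end Literature.MathematicalPhysics.QuantumFieldTheory.Balaban1983to89.B15Ineq142From190
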